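import Summits.HodgeConjecture.HodgeConjecture.Theorems.VHCAbelianSchemesRoadWeilLineThroughAnchor
import Summits.HodgeConjecture.HodgeConjecture.Theorems.Ring2AbelianAllOneSplitWeilAnchorCarrierDefs
import Summits.HodgeConjecture.HodgeConjecture.Theorems.VHCAbelianSchemesRoadSecantQuotientAnchorCMOneAnchorAmple
import Summits.HodgeConjecture.HodgeConjecture.Theorems.VHCAbelianSchemesRoadSecantAnchorInhabited
import Summits.HodgeConjecture.HodgeConjecture.Theorems.Ring2AbelianAllWeilHyperbolicDescent
import Literature.AlgebraicGeometry.Deligne1982.WeilTypeCMQuadratic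
import Literature.AlgebraicGeometry.HodgeTheory.WeilClassesOfIsogenyTransportOfStructure
import Literature.AlgebraicGeometry.Motives.RationalDegreeOneModelWeilType
import Literature.AlgebraicGeometry.Motives.AimedSplitProductProofs
import Summits.HodgeConjecture.HodgeConjecture.Theorems.VHCAbelianSchemesRoadTwistedDoor
import Summits.HodgeConjecture.HodgeConjecture.Theses.VHCAbelianSchemesRoad
import HarnessLib

/-!
# Ring 2 / AbelianAll (André column) × lane W1 — PRINT'S PINNED CLAIM L1″ SERVES THE `(6,3)` QUADRATIC CONJUNCT OF `B_min` (gen 63): Markman's secant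
# quotient `(J(C) × Ĵ(C))/Ḡ` IS a split anchor of type `(T + (d+1)²d, 1, 3)` carrying one class, in the André column's typing (fact-free junction)

research route, not a corollary; conditional on HC_CM plus one named minimal statement.

THEOREMS ONLY (no definition, no new named fact; Markman's claim-tagged L1″ `HodgeTheory.Markman2025_secantQuotient_twistedCarrier_onJacobian_pinned` enters BY
NAME as a hypothesis, UNREFEREED). PART AF named the node `OneSplitWeilAnchorCarriers 𝒪 R e₀ p` (ONE split `E`-Weil anchor of type `(R, e₀, p)` in André's
`(*)`-typing — `IsWeilTypeCM`, an `η₀`-COMPATIBLE hyperplane class, `IsHyperbolicWeilType` — carrying ONE non-zero rational `E`-Weil class at every chart). Lane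
W1 proved that L1″ yields the Weil ladder's one-anchor node `OneHyperbolicWeilCarrier (tw C Adm) 3 ((d+1)²d)` (`CMOneAnchorMarkman`, `CMOneAnchorAmple`), whose
polarisation is the `K`-SYMMETRISED class `d'·e^*a + ψ^*e^*a`; André's typing asks instead for the hyperplane class ITSELF to be `ψ`-compatible
(`Q_h(ψ^*x, y) = −Q_h(x, ψ^*y)`). This file supplies the missing form-level lemma and the junction:

* §1 `polarizationPairingOne_map_one_eq_neg_of_map_two_eq_smul` — for an abelian variety `A`, `φ ≫ φ = −d` (`d ≥ 1`) and a class `h` with `φ^*h = d·h`: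
  `Q_h(φ^*x, y) = −Q_h(x, φ^*y)` on `H¹` (van Geemen 4.9 «`E(φx, φy) = d·E(x, y)`» ⟺ Rosati = conjugation: naturality of `Q_h`, `Q_{dh} = d^j Q_h`, `φ^* = d^{dim A}`
  on the top cohomology (`Motives.map_top_eq_pow_smul`), then `φ^{*2} = −d`).
* §2 `SecantQuotientDatum.oneSplitWeilAnchorCarriers_of_copyDatum` — for a secant–quotient datum `D` (`Y = (J × Ĵ)/Ḡ`, level `d` even `≥ 4`), a polarisation class
  `θ₀` of `Θ`, a class `γ` (rational, ALGEBRAIC, off the ray `ℂ·h_Y(θ₀)³`, `q^*γ` a Weil class of `(J × Ĵ, φ_d)`), hyperbolicity of `(J × Ĵ, φ_d)` for `q^*h_Y(θ₀)`, and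
  an `𝒪`-datum on every copy pinned to `(h_Y(θ₀), γ)`: **`OneSplitWeilAnchorCarriers 𝒪 (T + (d+1)²d) 1 3`** with anchor `X₀ := Y`, `η₀ := ψ_Y = r ≫ φ_d ≫ q`
  (`ψ_Y² = −(d+1)²d`), hyperplane class `h_Y(θ₀) = e^*a` (lane W1's `exists_projectiveEmbedding_map_eq_hY`, Hartshorne II 7.6 — no Kodaira), `w₀ := γ`:
  `IsWeilTypeCM` from the non-zero algebraic (hence `(3,3)`) Weil class `γ` (Deligne–Milne Prop. 4.4 «only if», `isWeilType_of_weilClass_ne_zero`, quadratic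
  dictionary `isWeilTypeCM_quadratic_iff`); compatibility by §1 from `ψ_Y^*h_Y(θ₀) = (d+1)²d·h_Y(θ₀)` (`q^*h_Y = Ξ_d`, `φ_d^*Ξ_d = dΞ_d`, `[d+1]^* = (d+1)²`); hyperbolicity
  by lane W1's descent; the charts `(X, ε, θ = c·ε_*h_Y(θ₀))` are served by the every-copy datum with side coefficients rescaled by `c^{-k}`.
* §3 **`oneSplitWeilAnchorCarriers_of_markmanPinned`**: `Markman2025_secantQuotient_twistedCarrier_onJacobian_pinned C Adm ⟹
  OneSplitWeilAnchorCarriers (twistedReflexiveClass C Adm) (T + (d+1)²d) 1 3` for every even `d ≥ 4` (`γ` algebraic by `mem_algebraicClasses_of_twistedReflexiveClass`);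
  twisted-door form `oneSplitWeilAnchorTwistedCarriers_of_markmanPinned`. So the `(E quadratic, p = 3)` conjuncts of `OneSplitWeilAnchorTwistedCarriersAll` at the
  types `T + (d+1)²d` are PREPRINT-SERVED; every other quadratic type `T + r` is reached on the TARGET side by `η ↦ 2(4r+1)·η` (`d = 4r`; companion rows).

HONEST: L1″ is an UNREFEREED preprint claim entering by name; nothing here says L1″, any node, the door, `HC_CM`, `HC_AV` or HC holds; `HC_CM` does not occur.
References: [cite: Markman2025SecantWeil, §1.5 (p. 7), Thm. 1.4.1, Cor. 3.2.3, Lemma 9.3.11] [cite: vanGeemen1994HodgeAV, 4.9, Lemma 5.2 (2) and 5.4]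
[cite: Deligne1982HodgeCycles, §4 (4.4) and Prop. 4.4] [cite: LangeBirkenhake1992, Lemma 1.1.17 and Prop. 1.1.9] [cite: Hartshorne1977, II Thm. 7.6]
[cite: Andre1996Motifs, §6.3 b) (*) (p. 32)] [cite: Bloch1972Semiregularity, Remark (7.5)].
-/

noncomputable section

open CategoryTheory CategoryTheory.Limits AlgebraicGeometry Topology

namespace Summit.HodgeConjecture.HodgeConjecture.Ring2.SemiregularRepresentatives

-- the cell's namespace repeats the summit name (`Summit.HodgeConjecture.HodgeConjecture…`), as in every `Ring2*` file
set_option linter.dupNamespace false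

open Literature.AlgebraicGeometry Literature.AlgebraicGeometry.Motives Literature.AlgebraicGeometry.Motives.AbelianVariety
open Literature.AlgebraicGeometry.HodgeTheory Literature.AlgebraicGeometry.Markman2025
open Literature.AlgebraicGeometry.Deligne1982
open Literature.AlgebraicGeometry.VanGeemen1994 (pullbackOne)
open Literature.AlgebraicTopology.SingularHomology
open Summit.Ventures.HSemireg (ObjClass)
open Summit.HodgeConjecture.HodgeConjecture.Ring2.AbelianAll (carriedClasses OneSplitWeilAnchorCarriers OneSplitWeilAnchorTwistedCarriers
  isHyperbolicWeilType_natCast_zsmul_iff)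

/-! ## §1 Form-level compatibility from `φ^*h = d·h` -/

section Compat

variable {A : AbelianVariety ℂ} {φ : A ⟶ A} {d j : ℕ}

/-- **`Q_h(φ^*x, φ^*y) = d·Q_h(x, y)`** on `H¹(A(ℂ); ℂ)` for `dim A = j + 1`, `φ ≫ φ = −d` (`d ≥ 1`) and a class `h` with `φ^*h = d·h` (van Geemen 4.9:
`E(φx, φy) = d·E(x, y)`): naturality `φ^*Q_h(x, y) = Q_{φ^*h}(φ^*x, φ^*y)`, `Q_{dh} = d^j·Q_h`, and `φ^* = d^{j+1}` on `H^{2j+2}` (the degree of `φ`).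
[cite: vanGeemen1994HodgeAV, 4.9 and Lemma 5.2 (2)] [cite: LangeBirkenhake1992, Lemma 1.1.17 and Prop. 1.1.9] -/
theorem polarizationPairingOne_map_one_map_one_of_map_two_eq_smul (hA : A.dim = j + 1) (hd : 0 < d) (hφ : φ ≫ φ = -(d • 𝟙 A))
    {h : complexBetti A.X 2} (hh : complexBetti.map φ.hom.hom.hom 2 h = (d : ℂ) • h) (x y : complexBetti A.X 1) :
    polarizationPairingOne A.X h j (complexBetti.map φ.hom.hom.hom 1 x) (complexBetti.map φ.hom.hom.hom 1 y) =
      (d : ℂ) • polarizationPairingOne A.X h j x y := by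
  have hrank := Motives.abelianVarietyCohomologyExteriorH1.finrank_one Motives.abelianVarietyCohomologyExteriorH1_holds A
  have hspan := Motives.abelianVarietyCohomologyExteriorH1.span_range_cupPowOne Motives.abelianVarietyCohomologyExteriorH1_holds A (2 + 2 * j)
  have hdj : ((d : ℂ) ^ j) ≠ 0 := pow_ne_zero _ (Nat.cast_ne_zero.2 hd.ne')
  have e2 := Motives.map_polarizationPairingOne φ.hom.hom.hom h j x y
  rw [hh, Motives.polarizationPairingOne_smul, Motives.map_top_eq_pow_smul hA hrank hspan hd hφ, pow_succ, mul_smul] at e2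
  exact (smul_right_injective _ hdj e2).symm

/-- **`Q_h(φ^*x, y) = −Q_h(x, φ^*y)`: the Rosati involution of `h` induces complex conjugation on `K = ℚ(φ)`** — the `φ`-COMPATIBILITY clause of André's
`(*)`-data for ANY class `h` with `φ^*h = d·h` (`φ ≫ φ = −d`, `d ≥ 1`, `dim A = j + 1`): from `Q_h(φ^*x, φ^*y) = d·Q_h(x, y)` at `(x, φ^*y)` and `φ^*φ^* = −d` on `H¹`.
[cite: vanGeemen1994HodgeAV, 4.9 and Lemma 5.2 (2)] [cite: Andre1996Motifs, §6.3 b) (*) (p. 32)] [cite: LangeBirkenhake1992, Lemma 1.1.17] -/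
theorem polarizationPairingOne_map_one_eq_neg_of_map_two_eq_smul (hA : A.dim = j + 1) (hd : 0 < d) (hφ : φ ≫ φ = -(d • 𝟙 A))
    {h : complexBetti A.X 2} (hh : complexBetti.map φ.hom.hom.hom 2 h = (d : ℂ) • h) (x y : complexBetti A.X 1) :
    polarizationPairingOne A.X h j (complexBetti.map φ.hom.hom.hom 1 x) y =
      -polarizationPairingOne A.X h j x (complexBetti.map φ.hom.hom.hom 1 y) := by
  have hdC : (d : ℂ) ≠ 0 := Nat.cast_ne_zero.2 hd.ne'
  have e := polarizationPairingOne_map_one_map_one_of_map_two_eq_smul hA hd hφ hh x (complexBetti.map φ.hom.hom.hom 1 y)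
  rw [complexBetti_map_map_one_of_comp_self hφ, map_neg, map_smul] at e
  -- `e : -(d • Q(φ^*x, y)) = d • Q(x, φ^*y)`
  have e' : (d : ℂ) • (polarizationPairingOne A.X h j (complexBetti.map φ.hom.hom.hom 1 x) y +
      polarizationPairingOne A.X h j x (complexBetti.map φ.hom.hom.hom 1 y)) = 0 := by
    rw [smul_add, ← e, add_neg_cancel]
  exact eq_neg_of_add_eq_zero_left ((smul_eq_zero.1 e').resolve_left hdC)

end Compat

/-! ## §2 A secant–quotient datum with an every-copy datum pinned to `(h_Y(θ₀), γ)` IS a one-class split anchor of type `(T + (d+1)²d, 1, 3)` -/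

section Junction

variable {𝒪 : ObjClass}

/-- **THE JUNCTION (datum level, door-generic).** A secant–quotient datum `D` (`Y = (J × Ĵ)/Ḡ`, `dim J = 3`, level `d` even `≥ 4`), a polarisation class
`θ₀` of `Θ`, hyperbolicity of `(J × Ĵ, φ_d)` for `Ξ_d(θ₀) = q^*h_Y(θ₀)`, a class `γ` on `Y` — rational, ALGEBRAIC, off the ray `ℂ·h_Y(θ₀)³`, `q^*γ` a Weil class of
`(J × Ĵ, φ_d)` — and on EVERY copy `e : X' ≅ Y` an `𝒪`-datum `(I ∋ 3, κ)` with `κ₃ = e^*γ + c₃·(e^*h_Y(θ₀))³`, `κ_k = c_k·(e^*h_Y(θ₀))ᵏ` ⟹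
**`OneSplitWeilAnchorCarriers 𝒪 (T + (d+1)²d) 1 3`**: the anchor is `(Y, ψ_Y = r ≫ φ_d ≫ q, e^*a = h_Y(θ₀), γ)` — `IsWeilTypeCM` from the non-zero algebraic Weil class
`γ` (Prop. 4.4 «only if»), `ψ_Y`-compatibility of `h_Y(θ₀)` by §1 (`ψ_Y^*h_Y(θ₀) = (d+1)²d·h_Y(θ₀)`), hyperbolicity by descent along `q`, hyperplane pin by Hartshorne
II 7.6 (lane W1); at a chart `(X, ε, θ)` with `ε^*θ = c·h_Y(θ₀)` the copy datum at `ε⁻¹` serves `ε^{-1 *}γ` with side coefficients `c_k·c^{-k}`.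
[cite: Markman2025SecantWeil, §1.5 (p. 7), Thm. 1.4.1 and Cor. 3.2.3] [cite: Deligne1982HodgeCycles, §4 Prop. 4.4] [cite: vanGeemen1994HodgeAV, 4.9, Lemma 5.2 and 5.4]
[cite: Hartshorne1977, II Thm. 7.6] [cite: Bloch1972Semiregularity, Remark (7.5)] -/
theorem SecantQuotientDatum.oneSplitWeilAnchorCarriers_of_copyDatum (D : SecantQuotientDatum)
    {θ₀ : complexBetti D.𝒥.J.X 2} (hθ₀ : D.𝒥.J.IsPolarizationClassOf D.Θ θ₀) {γ : complexBetti D.Y.X (2 * 3)}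
    (hcopy : ∀ (X' : SchemeOver ℂ) (e : X' ≅ D.Y.X),
      ∃ (I : Finset ℕ) (κ : (k : ℕ) → complexBetti X' (2 * k)) (c : ℕ → ℂ),
        3 ∈ I ∧ 𝒪 6 X' I κ ∧
        κ 3 = complexBetti.map e.hom (2 * 3) γ + c 3 • cupPowTwo (complexBetti.map e.hom 2 (D.hY θ₀)) 3 ∧
        ∀ k ∈ I, k ≠ 3 → κ k = c k • cupPowTwo (complexBetti.map e.hom 2 (D.hY θ₀)) k)
    (halg : γ ∈ algebraicClasses D.Y.X 3)
    (hW : IsHyperbolicWeilType D.P D.ψ 3 (complexBetti.map D.q.hom.hom.hom 2 (D.hY θ₀)))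
    (hγQ : IsRationalClass γ) (hray : γ ∉ (ℂ ∙ cupPowTwo (D.hY θ₀) 3))
    (hmem : complexBetti.map D.q.hom.hom.hom (2 * 3) γ ∈ weilClassesOf D.P D.ψ 3 D.d) :
    OneSplitWeilAnchorCarriers 𝒪 (Polynomial.X + Polynomial.C (((D.d + 1) ^ 2 * D.d : ℕ) : ℤ)) 1 3 := by
  obtain ⟨r, hr⟩ := D.exists_q_comp_eq_nsmul_id
  have hd : 0 < D.d := by have := D.four_le; omega
  have hd' : 0 < (D.d + 1) ^ 2 * D.d := Nat.mul_pos (pow_pos (Nat.succ_pos D.d) 2) hd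
  have hrq : r ≫ D.q = (D.d + 1) • 𝟙 D.Y := by
    apply D.isIsogeny_q.cancel_left
    rw [← Category.assoc, hr, Preadditive.nsmul_comp, Category.id_comp, Preadditive.comp_nsmul, Category.comp_id]
  have hqinj : ∀ k, Function.Injective (complexBetti.map D.q.hom.hom.hom k) := fun k ↦ (D.complexBetti_map_q_bijective k).1
  -- the Weil plane of `(Y, ψ_Y)`
  have hiff : ∀ b : complexBetti D.Y.X (2 * 3), complexBetti.map D.q.hom.hom.hom (2 * 3) b ∈ weilClassesOf D.P D.ψ 3 D.d ↔
      b ∈ weilClassesOf D.Y (r ≫ D.ψ ≫ D.q) 3 ((D.d + 1) ^ 2 * D.d) := fun b ↦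
    map_mem_weilClassesOf_iff_of_comp_eq_nsmul_comp D.isIsogeny_q (comp_conj_eq_nsmul_comp D.q r hr D.ψ) D.ψ_comp_ψ_nsmul hd
      (Nat.succ_pos D.d)
  -- `ψ_Y^* h_Y(θ₀) = (d+1)²d · h_Y(θ₀)`
  have hψθ : complexBetti.map (r ≫ D.ψ ≫ D.q).hom.hom.hom 2 (D.hY θ₀) = ((((D.d + 1) ^ 2 * D.d : ℕ)) : ℂ) • D.hY θ₀ := by
    apply hqinj 2
    have hΞ : complexBetti.map D.ψ.hom.hom.hom 2 (complexBetti.map D.q.hom.hom.hom 2 (D.hY θ₀)) =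
        (D.d : ℂ) • complexBetti.map D.q.hom.hom.hom 2 (D.hY θ₀) := by
      rw [D.complexBetti_map_q_hY]
      exact complexBetti_map_weilOperator_weilPolarizationClass D.isAmple D.KTheta_eq_bot D.d θ₀
    rw [complexBetti_map_comp₃_apply, complexBetti_map_map_of_comp_eq_nsmul_id hr, hΞ, map_smul, smul_smul]
    congr 1
    push_cast
    ring
  -- the descended structure `ψ_Y`, its square, hyperbolicity
  have hψY : (r ≫ D.ψ ≫ D.q) ≫ (r ≫ D.ψ ≫ D.q) = -(((D.d + 1) ^ 2 * D.d) • 𝟙 D.Y) := conj_comp_conj D.q r hr hrq D.ψ_comp_ψ_nsmul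
  have hhypY : IsHyperbolicWeilType D.Y (r ≫ D.ψ ≫ D.q) 3 (D.hY θ₀) := isHyperbolicWeilType_descent (Nat.succ_ne_zero D.d) hr hqinj hW
  have hY6 : D.Y.dim = 2 * 3 := D.dim_Y
  -- `γ`: a non-zero rational algebraic (hence `(3,3)`) Weil class of `(Y, ψ_Y)`; so `(Y, ψ_Y)` is of Weil type
  have hγW : γ ∈ weilClassesOf D.Y (r ≫ D.ψ ≫ D.q) 3 ((D.d + 1) ^ 2 * D.d) := (hiff γ).1 hmem
  have hγ0 : γ ≠ 0 := fun h0 ↦ hray (by rw [h0]; exact Submodule.zero_mem _)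
  have hYsp : IsSmoothProjective (2 * 3) D.Y.X := Motives.isSmoothProjective_of_dim_eq' hY6
  have hγH : IsOfHodgeType (2 * 3) D.Y.X (2 * 3) 3 3 γ := isOfHodgeType_of_mem_algebraicClasses_of_isSmoothProjective hYsp 3 halg
  have hWT : IsWeilType D.Y (r ≫ D.ψ ≫ D.q) 3 ((D.d + 1) ^ 2 * D.d) := isWeilType_of_weilClass_ne_zero (by norm_num) hd' hY6 hψY hγW hγ0 hγH
  have hCM : IsWeilTypeCM D.Y (r ≫ D.ψ ≫ D.q) (Polynomial.X + Polynomial.C (((D.d + 1) ^ 2 * D.d : ℕ) : ℤ)) 1 3 := isWeilTypeCM_quadratic_iff.2 hWT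
  -- the hyperplane pin (Hartshorne II 7.6, lane W1)
  obtain ⟨e, a, ha, ha0, hea⟩ := D.exists_projectiveEmbedding_map_eq_hY hθ₀
  -- the `E`-Weil line in Deligne's presentation
  have hγF : γ ∈ weilClassesField D.Y (r ≫ D.ψ ≫ D.q) ((Polynomial.X + Polynomial.C (((D.d + 1) ^ 2 * D.d : ℕ) : ℤ)).comp (Polynomial.X ^ 2)) (2 * 3) := by
    rw [weilClassesField_X_add_C_comp_eq_weilClassesOf]
    exact hγW
  refine ⟨D.Y, r ≫ D.ψ ≫ D.q, e, a, γ, hCM, ha, ha0, ?_, ?_, hγF, hγQ, hγ0, ?_⟩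
  · -- compatibility of the hyperplane class `h_Y(θ₀)` with `ψ_Y` (§1)
    intro x y
    have h5 : D.Y.dim = (D.Y.dim - 1) + 1 := by rw [D.dim_Y]
    rw [hea]
    exact polarizationPairingOne_map_one_eq_neg_of_map_two_eq_smul h5 hd' hψY hψθ x y
  · -- hyperbolicity
    rw [hea]
    exact hhypY
  · -- the carried class at every chart `(X, ε, θ)` with `ε^*θ = c · h_Y(θ₀)`
    intro X' ε θ c hc hεθ _
    have hcC : (c : ℂ) ≠ 0 := by exact_mod_cast hc
    obtain ⟨I, κ, c₀, h3, h𝒪, hκ3, hκk⟩ := hcopy X' ε.symm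
    have hθ' : complexBetti.map ε.symm.hom 2 (D.hY θ₀) = ((c : ℂ))⁻¹ • θ := by
      have h1 : D.hY θ₀ = ((c : ℂ))⁻¹ • complexBetti.map ε.hom 2 θ := by
        rw [hεθ, hea, smul_smul, inv_mul_cancel₀ hcC, one_smul]
      rw [h1, map_smul, Iso.symm_hom, Iso.complexBetti_map_inv_map_hom]
    have hγ' : complexBetti.map ε.symm.hom (2 * 3) γ = complexBetti.map ε.inv (2 * 3) γ := by rw [Iso.symm_hom]
    rw [D.dim_Y]
    simp only [carriedClasses, Set.mem_setOf_eq]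
    refine ⟨I, κ, 1, fun k ↦ c₀ k * ((c : ℂ))⁻¹ ^ k, h3, h𝒪, one_ne_zero, ?_, fun k hk hk3 ↦ ?_⟩
    · rw [hκ3, hγ', hθ', cupPowTwo_smul, smul_smul, one_smul]
    · rw [hκk k hk hk3, hθ', cupPowTwo_smul, smul_smul]

end Junction

/-! ## §3 Print's pinned claim L1″ ⟹ the node at the types `T + (d+1)²d`, `d` even `≥ 4` -/

section Markman

/-- **L1″ ⟹ `OneSplitWeilAnchorCarriers (tw C Adm) (T + (d+1)²d) 1 3` for every even `d ≥ 4`**: Markman's pinned object-level claim on the Jacobian datum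
(`HodgeTheory.Markman2025_secantQuotient_twistedCarrier_onJacobian_pinned C Adm`, PREPRINT, by name) read on a secant–quotient datum (lane W1's
`exists_secantQuotientDatum_pinnedClauses_of_pinned`), `γ` algebraic as `κ₃ − c₃·h³` on the identity copy (`mem_algebraicClasses_of_twistedReflexiveClass`), then §2.
The André column's `(E quadratic, p = 3)` conjunct at these types is thereby PREPRINT-SERVED. Nothing here says L1″ holds.
[claim: Markman2025SecantWeil, status: under-review] [cite: Markman2025SecantWeil, Thm. 1.4.1, §1.5 and Lemma 9.3.11] [cite: Bloch1972Semiregularity, Remark (7.5)] -/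
theorem oneSplitWeilAnchorCarriers_of_markmanPinned {C : ChernCharacterBetti} {Adm : PerfectAdmissibility}
    (hM : Markman2025_secantQuotient_twistedCarrier_onJacobian_pinned C Adm) {d : ℕ} (hd : Even d) (h4 : 4 ≤ d) :
    OneSplitWeilAnchorCarriers (twistedReflexiveClass C Adm) (Polynomial.X + Polynomial.C (((d + 1) ^ 2 * d : ℕ) : ℤ)) 1 3 := by
  obtain ⟨D, θ₀, γ, rfl, hθ₀, hpol, -, hW, hγQ, hray, hmem, hcopy⟩ := exists_secantQuotientDatum_pinnedClauses_of_pinned hM hd h4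
  -- `γ` is algebraic: the datum on the identity copy
  have halg : γ ∈ algebraicClasses D.Y.X 3 := by
    obtain ⟨I, κ, c, h3, hκ, hκ3, -⟩ := hcopy D.Y.X (Iso.refl D.Y.X)
    have hid2 : complexBetti.map (Iso.refl D.Y.X).hom 2 (D.hY θ₀) = D.hY θ₀ := by rw [Iso.refl_hom, complexBetti.map_id]; rfl
    have hid6 : complexBetti.map (Iso.refl D.Y.X).hom (2 * 3) γ = γ := by rw [Iso.refl_hom, complexBetti.map_id]; rfl
    rw [hid2, hid6] at hκ3
    have hYsp : IsSmoothProjective D.Y.dim D.Y.X := AbelianVariety.isSmoothProjective_holds (A := D.Y)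
    have hκalg : κ 3 ∈ algebraicClasses D.Y.X 3 := mem_algebraicClasses_of_twistedReflexiveClass D.Y hκ h3
    have hh3 : cupPowTwo (D.hY θ₀) 3 ∈ algebraicClasses D.Y.X 3 :=
      cupPowTwo_mem_algebraicClasses_of_mem hYsp (D.dim_Y ▸ hpol).mem_algebraicClasses 3
    have hγeq : γ = κ 3 - c 3 • cupPowTwo (D.hY θ₀) 3 := by rw [hκ3, add_sub_cancel_right]
    rw [hγeq]
    exact Submodule.sub_mem _ hκalg (Submodule.smul_mem _ _ hh3)
  exact D.oneSplitWeilAnchorCarriers_of_copyDatum hθ₀ hcopy halg hW hγQ hray hmem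

/-- **Twisted door, every `C`: `(∀ C, L1″ C AdmTw) ⟹ OneSplitWeilAnchorTwistedCarriers (T + (d+1)²d) 1 3`** for every even `d ≥ 4` — the `(E quadratic, p = 3)` conjunct of
`OneSplitWeilAnchorTwistedCarriersAll` at these types, from print's pinned claim alone. [claim: Markman2025SecantWeil, status: under-review]
[cite: Markman2025SecantWeil, Thm. 1.4.1, §1.5 and §7.3] [cite: Bloch1972Semiregularity, Remark (7.5)] -/
theorem oneSplitWeilAnchorTwistedCarriers_of_markmanPinned
    (hM : ∀ C : ChernCharacterBetti, Markman2025_secantQuotient_twistedCarrier_onJacobian_pinned C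
      (fun n X₀ I E => Summit.Ventures.HSemireg.gluableSigmaAdmissible n X₀ I E ∨
        Literature.AlgebraicGeometry.HodgeTheory.bfSingleAdmissible n X₀ I E))
    {d : ℕ} (hd : Even d) (h4 : 4 ≤ d) :
    OneSplitWeilAnchorTwistedCarriers (Polynomial.X + Polynomial.C (((d + 1) ^ 2 * d : ℕ) : ℤ)) 1 3 :=
  fun C ↦ oneSplitWeilAnchorCarriers_of_markmanPinned (hM C) hd h4

end Markman

/-! ## §4 Every imaginary quadratic type: rescaling the TARGET's generator `η ↦ 2(4r+1)·η` lands in a Markman type `T + (d+1)²d`, `d = 4r` -/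

section EveryQuadraticType

variable {𝒪 : ObjClass} {B : AbelianVariety ℂ} {η : B ⟶ B} {r : ℕ} {e : ProjectiveEmbedding B.X} {a : complexBetti (projectiveSpace e.n ℂ) 2}

/-- **Rescaling the generator of a split quadratic target.** If `(B, η, e, a)` is a split `ℚ(√−r)`-Weil datum of type `(T + r, 1, 3)` (André's `(*)`), then for every
`m ≥ 1` so is `(B, m·η, e, a)` of type `(T + m²r, 1, 3)`: Weil type (`isWeilType_nsmul_iff`), compatibility (`(mη)^* = m·η^*` on `H¹`), hyperbolicity (a frame is
`η^*`-stable iff `(mη)^*`-stable), and the SAME Weil space (`W(B, mη, 3, m²r) = W(B, η, 3, r)`). «Two generators of the same `K ⊂ End⁰(B)` define the same notion.»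
[cite: vanGeemen1994HodgeAV, 4.9 and Lemma 5.2 (2)] [cite: MoonenZarhin1999LowDim, (1.9)] -/
theorem splitQuadraticDatum_nsmul (hB : IsWeilTypeCM B η (Polynomial.X + Polynomial.C (r : ℤ)) 1 3) {m : ℕ} (hm : 0 < m)
    (hRos : ∀ x y : complexBetti B.X 1,
      polarizationPairingOne B.X (complexBetti.map e.ι 2 a) (B.dim - 1) (pullbackOne B η x) y =
        -polarizationPairingOne B.X (complexBetti.map e.ι 2 a) (B.dim - 1) x (pullbackOne B η y))
    (hsplit : IsHyperbolicWeilType B η (3 * 1) (complexBetti.map e.ι 2 a)) :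
    IsWeilTypeCM B (m • η) (Polynomial.X + Polynomial.C ((m ^ 2 * r : ℕ) : ℤ)) 1 3 ∧
    (∀ x y : complexBetti B.X 1,
      polarizationPairingOne B.X (complexBetti.map e.ι 2 a) (B.dim - 1) (pullbackOne B (m • η) x) y =
        -polarizationPairingOne B.X (complexBetti.map e.ι 2 a) (B.dim - 1) x (pullbackOne B (m • η) y)) ∧
    IsHyperbolicWeilType B (m • η) (3 * 1) (complexBetti.map e.ι 2 a) ∧
    weilClassesField B (m • η) ((Polynomial.X + Polynomial.C ((m ^ 2 * r : ℕ) : ℤ)).comp (Polynomial.X ^ 2)) (2 * 3) =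
      weilClassesField B η ((Polynomial.X + Polynomial.C (r : ℤ)).comp (Polynomial.X ^ 2)) (2 * 3) := by
  have hWT : IsWeilType B η 3 r := isWeilTypeCM_quadratic_iff.1 hB
  refine ⟨isWeilTypeCM_quadratic_iff.2 (hWT.nsmul hm), fun x y ↦ ?_, ?_, ?_⟩
  · have hx : pullbackOne B (m • η) x = m • pullbackOne B η x := complexBetti_map_nsmul_deg_one m η x
    have hy : pullbackOne B (m • η) y = m • pullbackOne B η y := complexBetti_map_nsmul_deg_one m η y
    rw [hx, hy, map_nsmul, LinearMap.smul_apply, map_nsmul, hRos x y, smul_neg]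
  · rw [← natCast_zsmul]
    exact (isHyperbolicWeilType_natCast_zsmul_iff hm.ne').2 hsplit
  · rw [weilClassesField_X_add_C_comp_eq_weilClassesOf, weilClassesField_X_add_C_comp_eq_weilClassesOf]
    exact weilClassesOf_nsmul_eq_of_sq hWT.sq_eq hWT.d_pos hm 3

/-- `(2(4r+1))²·r = (4r+1)²·(4r)`: the rescaled generator of a `ℚ(√−r)`-target has Markman's level `d = 4r`. [folklore] -/
theorem sq_two_mul_mul_eq (r : ℕ) : (2 * (4 * r + 1)) ^ 2 * r = (4 * r + 1) ^ 2 * (4 * r) := by ring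

/-- **THE `(6,3)` SECTOR OF THE ANDRÉ COLUMN, PREPRINT-SERVED — EVERY imaginary quadratic type** (door-generic form): the door for `𝒪 = tw C Adm` ∧ the family fact
`andre1996_weilLineFamily_throughSplitAnchor` ∧ print's pinned claim L1″ for `(C, Adm)` ⟹ for EVERY split `ℚ(√−r)`-Weil sixfold datum `(B, η, e, a)` of type `(T + r, 1, 3)`:
`W(B) ⊗ ℂ ≤ algebraicClasses B.X 3`. Route: rescale the target to type `T + (d+1)²d` with `d = 4r` (previous lemmas), take Markman's anchor of that type (§3), run
the anchor engine. [claim: Markman2025SecantWeil, status: under-review] [cite: Markman2025SecantWeil, Thm. 1.4.1, §1.5 and Thm. 1.5.1]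
[cite: Andre1996Motifs, proof of Lemme 6.3.3 (p. 33)] [cite: Deligne1982HodgeCycles, §4 proof of Thm. 4.8] [cite: vanGeemen1994HodgeAV, 4.9] -/
theorem weilClassesField_le_algebraicClasses_quadraticSplitSixfold_of_markmanPinned_of_throughSplitAnchor {C : ChernCharacterBetti}
    {Adm : PerfectAdmissibility} (hT : Summit.Ventures.HSemireg.LocalVariationalHodgeFor (twistedReflexiveClass C Adm))
    (h : Literature.AlgebraicGeometry.Andre1996.andre1996_weilLineFamily_throughSplitAnchor)
    (hM : Markman2025_secantQuotient_twistedCarrier_onJacobian_pinned C Adm)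
    (hB : IsWeilTypeCM B η (Polynomial.X + Polynomial.C (r : ℤ)) 1 3) (ha : IsRationalClass a) (ha₀ : a ≠ 0)
    (hRos : ∀ x y : complexBetti B.X 1,
      polarizationPairingOne B.X (complexBetti.map e.ι 2 a) (B.dim - 1) (pullbackOne B η x) y =
        -polarizationPairingOne B.X (complexBetti.map e.ι 2 a) (B.dim - 1) x (pullbackOne B η y))
    (hsplit : IsHyperbolicWeilType B η (3 * 1) (complexBetti.map e.ι 2 a)) :
    weilClassesField B η ((Polynomial.X + Polynomial.C (r : ℤ)).comp (Polynomial.X ^ 2)) (2 * 3) ≤ algebraicClasses B.X 3 := by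
  have hr : 0 < r := (isWeilTypeCM_quadratic_iff.1 hB).d_pos
  -- Markman's type `T + (d+1)²d` with `d = 4r`, reached by `η ↦ 2(4r+1)·η`
  have hd : Even (4 * r) := ⟨2 * r, by ring⟩
  have h4 : 4 ≤ 4 * r := by omega
  have hm : 0 < 2 * (4 * r + 1) := by omega
  obtain ⟨hB', hRos', hsplit', hW'⟩ := splitQuadraticDatum_nsmul hB hm hRos hsplit
  rw [sq_two_mul_mul_eq] at hB' hW'
  -- the node at that type from L1″ (§3), unpacked
  obtain ⟨X₀, η₀, e', a', w₀, hX₀, ha', ha'₀, hRos₀, hsplit₀, hw₀W, hw₀Q, hw₀0, hcar⟩ := oneSplitWeilAnchorCarriers_of_markmanPinned hM hd h4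
  -- the anchor engine on the rescaled target, read back on the original Weil space
  rw [← hW']
  exact weilClassesField_le_algebraicClasses_of_throughSplitAnchor_of_door_of_carriedAtAnchor h hT (by norm_num) hX₀ ha' ha'₀ hRos₀ hsplit₀ hw₀W hw₀Q
    hw₀0 hcar hB' ha ha₀ hRos' hsplit'

/-- **Road-binder form: K-C ∧ `TwistedPerfectDoor` ∧ the family fact ∧ `(∀ C, L1″ C AdmTw)` ⟹ the codimension-3 Weil classes of EVERY split Weil SIXFOLD with
imaginary-quadratic multiplication are algebraic** (every type `(T + r, 1, 3)`; `AndreSplitWeilClasses` restricted to `e₀ = 1`, `p = 3`) — the André-format twin of lane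
W1's `weilClasses_algebraic_hyperbolic_of_reach_of_twistedPerfectDoor_of_markmanPinned` (there: the Weil ladder's `weilFamilyReach_hyperbolic` and the
`K`-symmetrised class; here: the general-CM-field family fact and André's `(*)`-data), i.e. Markman's Thm. 1.5.1 on the split components in the cell's currency.
Nothing here says L1″, the door or the family fact holds. [claim: Markman2025SecantWeil, status: under-review] [cite: Markman2025SecantWeil, Thm. 1.4.1 and Thm. 1.5.1]
[cite: Andre1996Motifs, proof of Lemme 6.3.3 (p. 33)] [cite: Deligne1982HodgeCycles, §4 proof of Thm. 4.8] [cite: Pridham2024Semiregularity, Cor. 2.25 and Rem. 2.26–2.27] -/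
theorem weilClassesField_le_algebraicClasses_quadraticSplitSixfold_of_markmanPinned_of_twistedPerfectDoor
    (hC : Theses.VHCAbelianSchemesRoad.ChernCharacterOnBetti) (hDoor : Theses.VHCAbelianSchemesRoad.TwistedPerfectDoor)
    (h : Literature.AlgebraicGeometry.Andre1996.andre1996_weilLineFamily_throughSplitAnchor)
    (hM : ∀ C : ChernCharacterBetti, Markman2025_secantQuotient_twistedCarrier_onJacobian_pinned C
      (fun n X₀ I E => Summit.Ventures.HSemireg.gluableSigmaAdmissible n X₀ I E ∨
        Literature.AlgebraicGeometry.HodgeTheory.bfSingleAdmissible n X₀ I E))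
    (hB : IsWeilTypeCM B η (Polynomial.X + Polynomial.C (r : ℤ)) 1 3) (ha : IsRationalClass a) (ha₀ : a ≠ 0)
    (hRos : ∀ x y : complexBetti B.X 1,
      polarizationPairingOne B.X (complexBetti.map e.ι 2 a) (B.dim - 1) (pullbackOne B η x) y =
        -polarizationPairingOne B.X (complexBetti.map e.ι 2 a) (B.dim - 1) x (pullbackOne B η y))
    (hsplit : IsHyperbolicWeilType B η (3 * 1) (complexBetti.map e.ι 2 a)) :
    weilClassesField B η ((Polynomial.X + Polynomial.C (r : ℤ)).comp (Polynomial.X ^ 2)) (2 * 3) ≤ algebraicClasses B.X 3 := by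
  obtain ⟨C⟩ := (hC : Nonempty ChernCharacterBetti)
  exact weilClassesField_le_algebraicClasses_quadraticSplitSixfold_of_markmanPinned_of_throughSplitAnchor
    ((twistedPerfectDoorVHC_iff_localVariationalHodgeFor (C := C) (Adm := _)).1 (hDoor C)) h (hM C) hB ha ha₀ hRos hsplit

end EveryQuadraticType

end Summit.HodgeConjecture.HodgeConjecture.Ring2.SemiregularRepresentatives

end
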